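import Summits.Ventures.HodgeRepro2.T5SU11AbelCosh

/-!
# The `Ξ`-transform of the coefficient modulus is `C_k²`, it is the minimum of the Jacobi transform
over its strip, and the Jacobi transform is log-convex in `λ`; `∫_ℝ cosh^{-ν} t dt = √π Γ(ν/2)/Γ((ν+1)/2)`

At `μ = 0` the Fourier–Laplace transform of `cosh^{-ν}` (`T5SU11AbelCosh`) and Legendre's duplication
formula give **`∫_ℝ cosh^{-ν} t dt = √π Γ(ν/2)/Γ((ν+1)/2)`** for `ν > 0` (`integral_cosh_rpow_neg`; in
particular `∫_ℝ sech t dt = π` and `∫_ℝ sech² t dt = 2`, `integral_inv_cosh`, `integral_inv_cosh_sq`).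
Through the Abel route (`A m_k = C_k cosh^{1−k}`) the `Ξ`-transform of the coefficient modulus is the
SQUARE of its Abel constant: **`∫_G (1 − |g·0|²)^{k/2} Ξ(g) dν = C_k² = π Γ((k−1)/2)²/Γ(k/2)²`** for
`k > 1` (`integral_orbit_rpow_mul_sph_one_eq_sq`). Since `Ξ ≤ φ_λ` pointwise, this is the MINIMUM of
the Jacobi transform over the strip `|λ − 1| < k − 1` (`xi_transform_le_jacobi`), and by the Bohr–Mollerup
log-convexity of `Γ` the Jacobi transform is **log-convex in `λ`** on the strip (`convexOn_log_jacobi`),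
symmetric about its minimum at the critical parameter `λ = 1`. Nothing is claimed about (N).

Blind lane: Mathlib + the HodgeRepro2 prefix only; no sorry; axioms ⊆ {propext, Classical.choice,
Quot.sound}.
-/

namespace Summit.Ventures.HodgeRepro2.T5SU11XiTransform

open MeasureTheory MeasureTheory.Measure Metric Set Filter Topology
open T5SU11Unimodular T5SU11Fibration T5SU11Cartan T5HaarCircle T5BergmanCoefficient
  T5SU11FibrationHaar T5SU11SphericalFunction T5SU11SphericalBounds T5SU11JacobiIwasawa
  T5SU11JacobiTransform T5SU11AbelTransform T5SU11AbelCosh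
open scoped Real

/-! ### `∫_ℝ cosh^{-ν}` -/

/-- **`∫_ℝ cosh^{-ν} t dt = √π Γ(ν/2)/Γ((ν+1)/2)`** for `ν > 0` (the `μ = 0` case of the Fourier–Laplace
transform and Legendre's duplication formula). -/
theorem integral_cosh_rpow_neg {ν : ℝ} (hν : 0 < ν) :
    ∫ t : ℝ, Real.cosh t ^ (-ν) = √π * Real.Gamma (ν / 2) / Real.Gamma ((ν + 1) / 2) := by
  have h := integral_exp_mul_cosh_rpow_neg (ν := ν) (μ := 0) hν (by linarith)
  simp only [zero_mul, Real.exp_zero, one_mul, add_zero, sub_zero] at h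
  rw [h]
  have hdup := Real.Gamma_mul_Gamma_add_half (ν / 2)
  rw [show ν / 2 + 1 / 2 = (ν + 1) / 2 by ring, show 2 * (ν / 2) = ν by ring] at hdup
  have hπ : 0 < π := Real.pi_pos
  have hs : 0 < √π := Real.sqrt_pos.mpr hπ
  have g1 : 0 < Real.Gamma (ν / 2) := Real.Gamma_pos_of_pos (by linarith)
  have g2 : 0 < Real.Gamma ((ν + 1) / 2) := Real.Gamma_pos_of_pos (by linarith)
  have g3 : 0 < Real.Gamma ν := Real.Gamma_pos_of_pos hν
  have h2 : (2 : ℝ) ^ (ν - 1) * 2 ^ (1 - ν) = 1 := by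
    rw [← Real.rpow_add (by norm_num), show ν - 1 + (1 - ν) = 0 by ring, Real.rpow_zero]
  have g3' : Real.Gamma ν ≠ 0 := g3.ne'
  rw [eq_div_iff g2.ne']
  -- `Γ(ν) 2^{1−ν} √π = Γ(ν/2) Γ((ν+1)/2)` (duplication) and `2^{ν−1} 2^{1−ν} = 1`
  have key : Real.Gamma ν * (2 : ℝ) ^ (1 - ν) * √π = Real.Gamma (ν / 2) * Real.Gamma ((ν + 1) / 2) :=
    hdup.symm
  calc 2 ^ (ν - 1) * (Real.Gamma (ν / 2) * Real.Gamma (ν / 2) / Real.Gamma ν) * Real.Gamma ((ν + 1) / 2)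
      = 2 ^ (ν - 1) * Real.Gamma (ν / 2) * (Real.Gamma (ν / 2) * Real.Gamma ((ν + 1) / 2)) / Real.Gamma ν := by
        ring
    _ = 2 ^ (ν - 1) * Real.Gamma (ν / 2) * (Real.Gamma ν * 2 ^ (1 - ν) * √π) / Real.Gamma ν := by
        rw [key]
    _ = √π * Real.Gamma (ν / 2) * (2 ^ (ν - 1) * 2 ^ (1 - ν)) := by field_simp
    _ = √π * Real.Gamma (ν / 2) := by rw [h2, mul_one]

/-- **`∫_ℝ sech t dt = π`.** -/
theorem integral_inv_cosh : ∫ t : ℝ, (Real.cosh t)⁻¹ = π := by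
  have h := integral_cosh_rpow_neg (ν := 1) one_pos
  simp only [Real.rpow_neg_one] at h
  rw [h, show (1 : ℝ) / 2 = 1 / 2 by rfl, Real.Gamma_one_half_eq, show ((1 : ℝ) + 1) / 2 = 1 by norm_num,
    Real.Gamma_one, div_one, Real.mul_self_sqrt Real.pi_pos.le]

/-- **`∫_ℝ sech² t dt = 2`.** -/
theorem integral_inv_cosh_sq : ∫ t : ℝ, (Real.cosh t)⁻¹ ^ 2 = 2 := by
  have h := integral_cosh_rpow_neg (ν := 2) two_pos
  have e : ∀ t : ℝ, Real.cosh t ^ (-(2 : ℝ)) = (Real.cosh t)⁻¹ ^ 2 := fun t => by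
    rw [Real.rpow_neg (Real.cosh_pos t).le, Real.rpow_two, inv_pow]
  simp_rw [e] at h
  rw [h, show (2 : ℝ) / 2 = 1 by norm_num, Real.Gamma_one, mul_one,
    show ((2 : ℝ) + 1) / 2 = 1 / 2 + 1 by norm_num, Real.Gamma_add_one (by norm_num),
    Real.Gamma_one_half_eq]
  have hs : 0 < √π := Real.sqrt_pos.mpr Real.pi_pos
  field_simp

section measure

variable [MeasurableSpace Circle] [BorelSpace Circle]

/-! ### The `Ξ`-transform of `m_k` -/

/-- **THE `Ξ`-TRANSFORM OF THE COEFFICIENT MODULUS IS THE SQUARE OF ITS ABEL CONSTANT**: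
`∫_G (1 − |g·0|²)^{k/2} Ξ(g) dν = (√π Γ((k−1)/2)/Γ(k/2))²` for `k > 1`. -/
theorem integral_orbit_rpow_mul_sph_one_eq_sq {k : ℝ} (hk : 1 < k) :
    ∫ g, (1 - ‖orbit g‖ ^ 2) ^ (k / 2) * sph 1 g ∂(nu haarCircle)
      = (√π * Real.Gamma ((k - 1) / 2) / Real.Gamma (k / 2)) ^ 2 := by
  rw [integral_orbit_rpow_mul_sph_abel hk (by linarith) (by linarith)]
  simp only [sub_self, zero_mul, Real.exp_zero, one_mul]
  rw [integral_cosh_rpow_neg (by linarith), show (k - 1 + 1) / 2 = k / 2 by ring, sq]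

/-- `∫_G m_k Ξ dν = π Γ((k−1)/2)²/Γ(k/2)²`. -/
theorem integral_orbit_rpow_mul_sph_one_eq {k : ℝ} (hk : 1 < k) :
    ∫ g, (1 - ‖orbit g‖ ^ 2) ^ (k / 2) * sph 1 g ∂(nu haarCircle)
      = π * Real.Gamma ((k - 1) / 2) ^ 2 / Real.Gamma (k / 2) ^ 2 := by
  rw [integral_orbit_rpow_mul_sph_one_eq_sq hk]
  have hπ : 0 < π := Real.pi_pos
  have hsq : √π * √π = π := Real.mul_self_sqrt hπ.le
  have g2 : 0 < Real.Gamma (k / 2) := Real.Gamma_pos_of_pos (by linarith)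
  field_simp
  linear_combination (Real.Gamma ((k - 1) / 2) ^ 2) * hsq

/-- **The `Ξ`-transform is the minimum of the Jacobi transform** (`Ξ ≤ φ_λ` pointwise): for `k > 1`,
`λ < k`, `k + λ > 2`, `∫_G m_k Ξ dν ≤ ∫_G m_k φ_λ dν`. -/
theorem xi_transform_le_jacobi {k lam : ℝ} (hk : 1 < k) (h1 : lam < k) (h2 : 2 < k + lam) :
    ∫ g, (1 - ‖orbit g‖ ^ 2) ^ (k / 2) * sph 1 g ∂(nu haarCircle)
      ≤ ∫ g, (1 - ‖orbit g‖ ^ 2) ^ (k / 2) * sph lam g ∂(nu haarCircle) := by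
  refine integral_mono (integrable_orbit_rpow_mul_sph hk (by linarith) (by linarith))
    (integrable_orbit_rpow_mul_sph hk h1 h2) fun g => ?_
  exact mul_le_mul_of_nonneg_left (sph_one_le lam g) (orbit_rpow_nonneg k g)

/-- The same, in closed form: `C_k² ≤ 2^{k−2} C_k Γ((k−λ)/2) Γ((k+λ)/2 − 1)/Γ(k − 1)` on the strip. -/
theorem sq_le_jacobi {k lam : ℝ} (hk : 1 < k) (h1 : lam < k) (h2 : 2 < k + lam) :
    (√π * Real.Gamma ((k - 1) / 2) / Real.Gamma (k / 2)) ^ 2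
      ≤ 2 ^ (k - 2) * (√π * Real.Gamma ((k - 1) / 2) / Real.Gamma (k / 2))
          * (Real.Gamma ((k - lam) / 2) * Real.Gamma ((k + lam) / 2 - 1) / Real.Gamma (k - 1)) := by
  rw [← integral_orbit_rpow_mul_sph_one_eq_sq hk, ← integral_orbit_rpow_mul_sph hk h1 h2]
  exact xi_transform_le_jacobi hk h1 h2

/-! ### Log-convexity in the parameter -/

/-- **The Jacobi transform of `m_k` is log-convex in `λ` on its strip** (Bohr–Mollerup). -/
theorem convexOn_log_jacobi {k : ℝ} (hk : 1 < k) :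
    ConvexOn ℝ (Ioo (2 - k) k)
      (fun lam => Real.log (∫ g, (1 - ‖orbit g‖ ^ 2) ^ (k / 2) * sph lam g ∂(nu haarCircle))) := by
  have hΓ : 0 < Real.Gamma (k - 1) := Real.Gamma_pos_of_pos (by linarith)
  have hC : 0 < 2 ^ (k - 2) * (√π * Real.Gamma ((k - 1) / 2) / Real.Gamma (k / 2)) := by
    have g1 : 0 < Real.Gamma ((k - 1) / 2) := Real.Gamma_pos_of_pos (by linarith)
    have g2 : 0 < Real.Gamma (k / 2) := Real.Gamma_pos_of_pos (by linarith)
    have g3 : (0 : ℝ) < 2 ^ (k - 2) := Real.rpow_pos_of_pos (by norm_num) _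
    have hs : 0 < √π := Real.sqrt_pos.mpr Real.pi_pos
    positivity
  -- the closed form as a sum of logs
  have e : ∀ lam ∈ Ioo (2 - k) k,
      Real.log (∫ g, (1 - ‖orbit g‖ ^ 2) ^ (k / 2) * sph lam g ∂(nu haarCircle))
        = Real.log (2 ^ (k - 2) * (√π * Real.Gamma ((k - 1) / 2) / Real.Gamma (k / 2)) / Real.Gamma (k - 1))
          + (Real.log (Real.Gamma ((k - lam) / 2)) + Real.log (Real.Gamma ((k + lam) / 2 - 1))) := by
    intro lam hlam
    have g3 : 0 < Real.Gamma ((k - lam) / 2) := Real.Gamma_pos_of_pos (by linarith [hlam.2])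
    have g4 : 0 < Real.Gamma ((k + lam) / 2 - 1) := Real.Gamma_pos_of_pos (by linarith [hlam.1])
    rw [integral_orbit_rpow_mul_sph hk hlam.2 (by linarith [hlam.1]),
      show 2 ^ (k - 2) * (√π * Real.Gamma ((k - 1) / 2) / Real.Gamma (k / 2))
          * (Real.Gamma ((k - lam) / 2) * Real.Gamma ((k + lam) / 2 - 1) / Real.Gamma (k - 1))
        = (2 ^ (k - 2) * (√π * Real.Gamma ((k - 1) / 2) / Real.Gamma (k / 2)) / Real.Gamma (k - 1))
          * (Real.Gamma ((k - lam) / 2) * Real.Gamma ((k + lam) / 2 - 1)) by ring,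
      Real.log_mul (by positivity) (by positivity), Real.log_mul g3.ne' g4.ne']
  refine ⟨convex_Ioo _ _, fun x hx y hy a b ha hb hab => ?_⟩
  have hxy : a • x + b • y ∈ Ioo (2 - k) k := (convex_Ioo _ _) hx hy ha hb hab
  simp only [smul_eq_mul] at hxy ⊢
  rw [e _ hxy, e _ hx, e _ hy]
  -- Bohr–Mollerup at the two affine arguments
  have hlog := Real.convexOn_log_Gamma
  have c1 := hlog.2 (show (k - x) / 2 ∈ Ioi (0 : ℝ) from by simp only [mem_Ioi]; linarith [hx.2])
    (show (k - y) / 2 ∈ Ioi (0 : ℝ) from by simp only [mem_Ioi]; linarith [hy.2]) ha hb hab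
  have c2 := hlog.2 (show (k + x) / 2 - 1 ∈ Ioi (0 : ℝ) from by simp only [mem_Ioi]; linarith [hx.1])
    (show (k + y) / 2 - 1 ∈ Ioi (0 : ℝ) from by simp only [mem_Ioi]; linarith [hy.1]) ha hb hab
  simp only [Function.comp, smul_eq_mul] at c1 c2
  rw [show a * ((k - x) / 2) + b * ((k - y) / 2) = (k - (a * x + b * y)) / 2 by
        linear_combination (k / 2) * hab,
      show a * ((k + x) / 2 - 1) + b * ((k + y) / 2 - 1) = (k + (a * x + b * y)) / 2 - 1 by
        linear_combination (k / 2 - 1) * hab] at *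
  set L := Real.log (2 ^ (k - 2) * (√π * Real.Gamma ((k - 1) / 2) / Real.Gamma (k / 2)) / Real.Gamma (k - 1))
  have : a * L + b * L = L := by linear_combination L * hab
  linarith [c1, c2]

end measure

end Summit.Ventures.HodgeRepro2.T5SU11XiTransform
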